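import Mathlib
import Summits.ValiantsHypothesis.ValiantsHypothesis.Theorems.GeneratorObstructionsPowGenDegreeQPBorelDense
import Summits.ValiantsHypothesis.ValiantsHypothesis.Theorems.GeneratorObstructionsGenInheritanceBase
import Summits.ValiantsHypothesis.ValiantsHypothesis.Theorems.GeneratorObstructionsGenFlipThesisSliceTransfer

/-!
# Route GeneratorObstructions — crux K2 `PowGenDegreeQP` (stmt-ValiantsHypothesis-11655), line
# `trace-side-regimes`: EVALUATION LATENESS — a nonvanishing semi-invariant at a symmetric point
# forces a late generator type

Helper file (`--supports stmt-ValiantsHypothesis-11655`; the mechanism serves K1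
`PerGenDegreeSuperQP`, stmt-ValiantsHypothesis-11654, verbatim as well).  New METHOD for the one thing
both registered stubs and both cruxes are about — LATE minimal generators of a covariant algebra
`A(f) = ⊕_χ HWV_χ(k[Δ_m f])` — which none of the landed files reaches: they produce generator types
only as ATOMS of the occurrence monoid (a monoid-level notion), whereas here lateness is read off the
ALGEBRA through a character of it.

Let `ev : k[Δ_m f] → k` be evaluation at the base point `f` (tree `evalAtPoint`, MS08 Prop. 4.2), an
algebra homomorphism.

1. `evalAtPoint_eq_zero_of_fix_of_weightChar_ne_one` — if an upper triangular `t` FIXES `f`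
   (`t · f = f`) then every highest-weight vector of a weight `χ` with `χ(t) ≠ 1` vanishes at `f`
   (left semi-invariance `x((t·1)·f) = χ(t)⁻¹ x(f)`, tree `BorelDense`).  So the weights of
   semi-invariants NOT vanishing at `f` are annihilated by the whole upper-triangular stabiliser of `f`.
2. `exists_genType_of_not_le_ker_evalAtPoint` — **evaluation lateness** (abstract form): let `Big` be
   any predicate on weights.  If every highest-weight vector of NONCONSTANT weight `χ` with `¬ Big χ`
   vanishes at `f`, while SOME highest-weight vector of nonconstant weight does not, then `A(f)` has a
   GENERATOR TYPE (`γ_χ ≠ 0`) that is nonconstant and `Big`.  (Induction on `-|χ|`: a non-generator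
   weight space lies in `Σ HWV_χ₁ · HWV_χ₂`; one factor is nonconstant and strictly earlier; `ker ev`
   is an ideal.)
3. `highestWeightSpace_le_ker_evalAtPoint_of_stabilizer` + `exists_late_genType_of_stabilizer` — the
   torus/stabiliser form: given upper triangular elements `t ∈ S` fixing `f` and an arithmetic
   statement "every nonconstant nonpositive weight annihilated by all `t ∈ S` has `-|χ| ≥ D`", a
   nonconstant semi-invariant not vanishing at `f` forces a generator type of `A(f)` with `-|χ| ≥ D`
   (degree `≥ D/m`).  This is the covariant analogue of the Grosshans/Derksen–Makam transfer: the
   arithmetic of the stabiliser torus (which can force EXPONENTIAL `D` for sparse `f`, cf. the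
   interleaved "doubling" supports recorded on the item) is converted into generator degrees, the only
   remaining input being ONE nonvanishing nonconstant semi-invariant (a Kempf–Hilbert–Mumford
   semistability statement for the pair `(f, v_χ)`).
4. `not_powGenDegreeQP_of_evalLate` / `not_sliceGen_of_evalLate` — consequence for the crux: a
   window-easy family (`pc(g) ≤ m + e` in the window, tree `genQP_of_powGenDegreeQP_of_hasPowTraceRepr`)
   carrying such an evaluation-lateness package with `D > m · 2^((log₂ m + c₀)^c₀)` REFUTES K2 and the
   registered `stub_sliceGen`.

Honest framing: a proved general mechanism + conditional refutation format; no stub, crux or summit is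
settled here; whether a window-easy family with the package exists is recorded (with an explicit
candidate and the one missing GIT lemma) on the item, not claimed.  `VP ≠ VNP` untouched.

References: Mulmuley–Sohoni, SIAM J. Comput. 38 (2008) Prop. 4.2 (evaluation at the point);
Derksen–Makam, Adv. Math. 368 (2020) §1 (Grosshans transfer of degree lower bounds);
G. Kempf, Ann. of Math. 108 (1978) Thm. 3.4, Cor. 3.5 (the missing input, not used here).
-/

namespace Summit.ValiantsHypothesis.ValiantsHypothesis.Theorems.GeneratorObstructions.PowGenDegreeQP

open MvPolynomial
open Literature.NumberTheory.DiophantineGeometry Literature.Computability.AlgebraicComplexity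
  Literature.Barriers.ValiantsHypothesis
open Summit.ValiantsHypothesis.ValiantsHypothesis.Theses.GeneratorObstructions
open Summit.ValiantsHypothesis.ValiantsHypothesis.Theorems.GenInheritance
open Summit.ValiantsHypothesis.ValiantsHypothesis.Theorems.GeneratorObstructions.SliceTransfer

-- `Summit.ValiantsHypothesis.ValiantsHypothesis.…` is the tree's mandated single-conjunct layout.
set_option linter.dupNamespace false

noncomputable section

section General

variable {σ : Type*} [Fintype σ] [LinearOrder σ]

/-! ## 1. The stabiliser annihilates the weights of semi-invariants not vanishing at the point -/

/-- **An upper triangular element fixing `f` acts trivially on the weights seen at `f`.** If `t` is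
upper triangular with `t · f = f` and `x ∈ HWV_χ(k[Δ_m f])` with `χ(t) ≠ 1`, then `x(f) = 0`:
`x(f) = x((t · 1) · f) = χ(t)⁻¹ · x(1 · f)`. [cite: MulmuleySohoniGCT2SIAM2008, Prop. 4.2] -/
theorem evalAtPoint_eq_zero_of_fix_of_weightChar_ne_one (f : MvPolynomial σ ℂ) (m : ℕ)
    {t : GL σ ℂ} (ht : IsUpperTriangular t) (hfix : linSubstRep σ ℂ t f = f)
    {χ : Weight σ} {x : OrbitCoordRing f m} (hx : x ∈ highestWeightSpace (orbitCoordRep f m) χ)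
    (hχ : weightChar χ t ≠ 1) : evalAtPoint f m x = 0 := by
  have h1 := evalAtPoint_orbitCoordRep_mul_inv_of_mem_highestWeightSpace hx ht (1 : GL σ ℂ)
  have h2 : evalAtPoint f m (orbitCoordRep f m (t * 1)⁻¹ x) =
      evalAtPoint f m (orbitCoordRep f m (1 : GL σ ℂ)⁻¹ x) := by
    apply evalAtPoint_orbitCoordRep_inv_congr
    rw [mul_one, hfix, map_one, Module.End.one_apply]
  rw [h2, inv_one, map_one, Module.End.one_apply] at h1
  -- `h1 : ev x = (χ t)⁻¹ * ev x`
  have hne : (weightChar χ t)⁻¹ ≠ 1 := fun h => hχ (inv_eq_one.mp h)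
  by_contra hx0
  have : (weightChar χ t)⁻¹ = 1 := by
    have h3 : ((weightChar χ t)⁻¹ - 1) * evalAtPoint f m x = 0 := by rw [sub_mul, one_mul, ← h1, sub_self]
    rcases mul_eq_zero.mp h3 with h | h
    · exact sub_eq_zero.mp h
    · exact absurd h hx0
  exact hne this

/-- The same, as an inclusion `HWV_χ ≤ ker ev`. [cite: MulmuleySohoniGCT2SIAM2008, Prop. 4.2] -/
theorem highestWeightSpace_le_ker_evalAtPoint_of_fix (f : MvPolynomial σ ℂ) (m : ℕ)
    {t : GL σ ℂ} (ht : IsUpperTriangular t) (hfix : linSubstRep σ ℂ t f = f)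
    {χ : Weight σ} (hχ : weightChar χ t ≠ 1) :
    highestWeightSpace (orbitCoordRep f m) χ ≤ LinearMap.ker (evalAtPoint f m).toLinearMap :=
  fun _ hx => LinearMap.mem_ker.mpr (evalAtPoint_eq_zero_of_fix_of_weightChar_ne_one f m ht hfix hx hχ)

/-! ## 2. Evaluation lateness (abstract form) -/

omit [LinearOrder σ] in
/-- The size of a sum of weights is the sum of the sizes. [folklore] -/
theorem size_add' (χ₁ χ₂ : Weight σ) : Weight.size (χ₁ + χ₂) = Weight.size χ₁ + Weight.size χ₂ := by
  simp only [Weight.size, Pi.add_apply, Finset.sum_add_distrib]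

omit [LinearOrder σ] in
/-- A nonpositive nonzero weight has negative size. [folklore] -/
theorem size_neg_of_nonpos_of_ne_zero {χ : Weight σ} (hle : ∀ i, χ i ≤ 0) (hne : χ ≠ 0) :
    Weight.size χ < 0 := by
  classical
  obtain ⟨i, hi⟩ : ∃ i, χ i ≠ 0 := by
    by_contra hall
    push Not at hall
    exact hne (funext fun i => by rw [hall i]; rfl)
  have hlt : χ i < 0 := lt_of_le_of_ne (hle i) hi
  have h1 : Weight.size χ = χ i + ∑ j ∈ Finset.univ.erase i, χ j :=
    (Finset.add_sum_erase _ _ (Finset.mem_univ i)).symm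
  have h2 : ∑ j ∈ Finset.univ.erase i, χ j ≤ 0 := Finset.sum_nonpos fun j _ => hle j
  omega

omit [Fintype σ] [LinearOrder σ] in
/-- A weight is *nonconstant* if it takes two different values; the sum of two constant weights is
constant (contrapositive form used in the induction). [folklore] -/
theorem exists_ne_of_add_eq {χ χ₁ χ₂ : Weight σ} (hsum : χ₁ + χ₂ = χ) (hχ : ∃ i j, χ i ≠ χ j)
    (h1 : ¬ ∃ i j, χ₁ i ≠ χ₁ j) : ∃ i j, χ₂ i ≠ χ₂ j := by
  obtain ⟨i, j, hij⟩ := hχ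
  push Not at h1
  refine ⟨i, j, fun h => hij ?_⟩
  rw [← hsum, Pi.add_apply, Pi.add_apply, h1 i j, h]

/-- **Evaluation lateness (abstract form).** Let `f` be a form on `σ`, inner degree `m ≠ 0`, and
`Big` any predicate on weights. Suppose (i) every highest-weight vector of a NONCONSTANT weight `χ`
with `¬ Big χ` vanishes at the base point `f`, and (ii) some highest-weight vector of a nonconstant
weight does not vanish at `f`. Then the covariant algebra `A(Δ_m f)` has a generator type
(`γ_χ ≠ 0`) which is nonconstant and `Big`.  Proof: otherwise, by induction on `-|χ|`, every
nonconstant weight space lies in `ker ev`: a non-generator `HWV_χ` lies in `Σ HWV_χ₁·HWV_χ₂`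
(`χ₁ + χ₂ = χ`, `χᵢ ≠ 0`), one factor is nonconstant and — the other being a nonzero occurring, hence
negative-size, weight — strictly earlier, and `ker ev` is an ideal. [cite: MulmuleySohoniGCT2SIAM2008, Prop. 4.2] -/
theorem exists_genType_of_not_le_ker_evalAtPoint (f : MvPolynomial σ ℂ) {m : ℕ} (hm : m ≠ 0)
    (Big : Weight σ → Prop)
    (h1 : ∀ χ : Weight σ, (∃ i j, χ i ≠ χ j) → ¬ Big χ →
      highestWeightSpace (orbitCoordRep f m) χ ≤ LinearMap.ker (evalAtPoint f m).toLinearMap)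
    (h2 : ∃ χ₀ : Weight σ, (∃ i j, χ₀ i ≠ χ₀ j) ∧
      ¬ highestWeightSpace (orbitCoordRep f m) χ₀ ≤ LinearMap.ker (evalAtPoint f m).toLinearMap) :
    ∃ χ : Weight σ, (∃ i j, χ i ≠ χ j) ∧ Big χ ∧
      Module.finrank ℂ (↥(highestWeightSpace (orbitCoordRep f m) χ) ⧸
        Submodule.comap (highestWeightSpace (orbitCoordRep f m) χ).subtype
          (⨆ p : Weight σ × Weight σ, ⨆ (_ : p.1 + p.2 = χ ∧ p.1 ≠ 0 ∧ p.2 ≠ 0),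
            highestWeightSpace (orbitCoordRep f m) p.1 * highestWeightSpace (orbitCoordRep f m) p.2)) ≠ 0 := by
  classical
  haveI : Infinite ℂ := CharZero.infinite ℂ
  by_contra hno
  push Not at hno
  -- `hno : ∀ χ, nonconstant χ → Big χ → γ_χ = 0`
  set K : Submodule ℂ (OrbitCoordRing f m) := LinearMap.ker (evalAtPoint f m).toLinearMap with hK
  have hideal_left : ∀ (S T : Submodule ℂ (OrbitCoordRing f m)), S ≤ K → S * T ≤ K := by
    intro S T hS
    rw [Submodule.mul_le]
    intro a ha b _
    rw [hK, LinearMap.mem_ker, AlgHom.toLinearMap_apply, map_mul]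
    have ha' := hS ha
    rw [hK, LinearMap.mem_ker, AlgHom.toLinearMap_apply] at ha'
    rw [ha', zero_mul]
  have hideal_right : ∀ (S T : Submodule ℂ (OrbitCoordRing f m)), T ≤ K → S * T ≤ K := by
    intro S T hT
    rw [Submodule.mul_le]
    intro a _ b hb
    rw [hK, LinearMap.mem_ker, AlgHom.toLinearMap_apply, map_mul]
    have hb' := hT hb
    rw [hK, LinearMap.mem_ker, AlgHom.toLinearMap_apply] at hb'
    rw [hb', mul_zero]
  -- the induction on `-|χ|`
  have key : ∀ n : ℕ, ∀ χ : Weight σ, (-(Weight.size χ)).toNat < n → (∃ i j, χ i ≠ χ j) →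
      highestWeightSpace (orbitCoordRep f m) χ ≤ K := by
    intro n
    induction n with
    | zero => intro χ hlt; exact absurd hlt (Nat.not_lt_zero _)
    | succ n ih =>
      intro χ hlt hnc
      by_cases hB : Big χ
      swap
      · exact h1 χ hnc hB
      -- `χ` is nonconstant and `Big`, hence not a generator type
      have hγ := hno χ hnc hB
      haveI := finiteDimensional_highestWeightSpace_orbitCoordRep_holds f (m := m) hm χ
      have hle : highestWeightSpace (orbitCoordRep f m) χ ≤
          ⨆ p : Weight σ × Weight σ, ⨆ (_ : p.1 + p.2 = χ ∧ p.1 ≠ 0 ∧ p.2 ≠ 0),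
            highestWeightSpace (orbitCoordRep f m) p.1 * highestWeightSpace (orbitCoordRep f m) p.2 := by
        by_contra hnle
        exact (finrank_quotient_comap_subtype_ne_zero_iff _ _).mpr hnle hγ
      refine hle.trans (iSup_le fun p => iSup_le fun hp => ?_)
      obtain ⟨hsum, hp1, hp2⟩ := hp
      by_cases hb1 : highestWeightSpace (orbitCoordRep f m) p.1 = ⊥
      · rw [hb1, Submodule.bot_mul]; exact bot_le
      by_cases hb2 : highestWeightSpace (orbitCoordRep f m) p.2 = ⊥
      · rw [hb2, Submodule.mul_bot]; exact bot_le
      -- both summands occur: they are nonpositive of negative size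
      have hocc1 : HasHighestWeight (orbitCoordRep f m) p.1 := hb1
      have hocc2 : HasHighestWeight (orbitCoordRep f m) p.2 := hb2
      obtain ⟨hle1, -⟩ := nonpos_and_exists_size_eq_of_hasHighestWeight_orbitCoordRep _ hocc1
      obtain ⟨hle2, -⟩ := nonpos_and_exists_size_eq_of_hasHighestWeight_orbitCoordRep _ hocc2
      have hs1 := size_neg_of_nonpos_of_ne_zero hle1 hp1
      have hs2 := size_neg_of_nonpos_of_ne_zero hle2 hp2
      have hsz : Weight.size χ = Weight.size p.1 + Weight.size p.2 := by rw [← hsum, size_add']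
      by_cases hnc1 : ∃ i j, p.1 i ≠ p.1 j
      · -- the first factor is nonconstant and strictly earlier
        have hlt1 : (-(Weight.size p.1)).toNat < n := by omega
        exact hideal_left _ _ (ih p.1 hlt1 hnc1)
      · have hnc2 : ∃ i j, p.2 i ≠ p.2 j := exists_ne_of_add_eq hsum hnc hnc1
        have hlt2 : (-(Weight.size p.2)).toNat < n := by omega
        exact hideal_right _ _ (ih p.2 hlt2 hnc2)
  obtain ⟨χ₀, hnc₀, hnot⟩ := h2
  exact hnot (key _ χ₀ (Nat.lt_succ_self _) hnc₀)

/-! ## 3. The stabiliser form -/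

/-- **Weights seen at `f` are annihilated by the upper-triangular stabiliser**, packaged: if `S` is a
set of upper triangular elements fixing `f` and every NONCONSTANT nonpositive weight annihilated by
all of `S` has `-|χ| ≥ D`, then every highest-weight vector of a nonconstant weight with `-|χ| < D`
vanishes at `f` (hypothesis (i) of `exists_genType_of_not_le_ker_evalAtPoint` with
`Big χ := D ≤ -|χ|`). [cite: MulmuleySohoniGCT2SIAM2008, Prop. 4.2] -/
theorem highestWeightSpace_le_ker_evalAtPoint_of_stabilizer (f : MvPolynomial σ ℂ) (m : ℕ)
    (S : Set (GL σ ℂ)) (hS : ∀ t ∈ S, IsUpperTriangular t ∧ linSubstRep σ ℂ t f = f) (D : ℤ)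
    (harith : ∀ χ : Weight σ, (∃ i j, χ i ≠ χ j) → (∀ i, χ i ≤ 0) →
      (∀ t ∈ S, weightChar χ t = 1) → D ≤ -(Weight.size χ)) :
    ∀ χ : Weight σ, (∃ i j, χ i ≠ χ j) → ¬ (D ≤ -(Weight.size χ)) →
      highestWeightSpace (orbitCoordRep f m) χ ≤ LinearMap.ker (evalAtPoint f m).toLinearMap := by
  classical
  haveI : Infinite ℂ := CharZero.infinite ℂ
  intro χ hnc hsmall x hx
  rw [LinearMap.mem_ker, AlgHom.toLinearMap_apply]
  by_cases hx0 : x = 0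
  · rw [hx0, map_zero]
  -- `χ` occurs, hence is nonpositive
  have hocc : HasHighestWeight (orbitCoordRep f m) χ := by
    intro hbot
    rw [hbot, Submodule.mem_bot] at hx
    exact hx0 hx
  obtain ⟨hle, -⟩ := nonpos_and_exists_size_eq_of_hasHighestWeight_orbitCoordRep _ hocc
  by_cases hall : ∀ t ∈ S, weightChar χ t = 1
  · exact absurd (harith χ hnc hle hall) hsmall
  · push Not at hall
    obtain ⟨t, htS, hχt⟩ := hall
    exact evalAtPoint_eq_zero_of_fix_of_weightChar_ne_one f m (hS t htS).1 (hS t htS).2 hx hχt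

/-- **Evaluation lateness, stabiliser form.** Let `f` be a form, `m ≠ 0`, `S` a set of upper
triangular elements fixing `f` such that every nonconstant nonpositive weight annihilated by `S` has
`-|χ| ≥ D`. If some highest-weight vector of NONCONSTANT weight does not vanish at `f`, then `A(Δ_m f)`
has a nonconstant generator type `χ` with `-|χ| ≥ D` (degree `≥ D/m`). The arithmetic of the
stabiliser torus is thereby converted into generator degrees (covariant analogue of the Grosshans /
Derksen–Makam transfer). [cite: MulmuleySohoniGCT2SIAM2008, Prop. 4.2] -/
theorem exists_late_genType_of_stabilizer (f : MvPolynomial σ ℂ) {m : ℕ} (hm : m ≠ 0)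
    (S : Set (GL σ ℂ)) (hS : ∀ t ∈ S, IsUpperTriangular t ∧ linSubstRep σ ℂ t f = f) (D : ℤ)
    (harith : ∀ χ : Weight σ, (∃ i j, χ i ≠ χ j) → (∀ i, χ i ≤ 0) →
      (∀ t ∈ S, weightChar χ t = 1) → D ≤ -(Weight.size χ))
    (h2 : ∃ χ₀ : Weight σ, (∃ i j, χ₀ i ≠ χ₀ j) ∧
      ∃ x ∈ highestWeightSpace (orbitCoordRep f m) χ₀, evalAtPoint f m x ≠ 0) :
    ∃ χ : Weight σ, (∃ i j, χ i ≠ χ j) ∧ D ≤ -(Weight.size χ) ∧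
      Module.finrank ℂ (↥(highestWeightSpace (orbitCoordRep f m) χ) ⧸
        Submodule.comap (highestWeightSpace (orbitCoordRep f m) χ).subtype
          (⨆ p : Weight σ × Weight σ, ⨆ (_ : p.1 + p.2 = χ ∧ p.1 ≠ 0 ∧ p.2 ≠ 0),
            highestWeightSpace (orbitCoordRep f m) p.1 * highestWeightSpace (orbitCoordRep f m) p.2)) ≠ 0 := by
  refine exists_genType_of_not_le_ker_evalAtPoint f hm (fun χ => D ≤ -(Weight.size χ))
    (highestWeightSpace_le_ker_evalAtPoint_of_stabilizer f m S hS D harith) ?_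
  obtain ⟨χ₀, hnc, x, hx, hx0⟩ := h2
  exact ⟨χ₀, hnc, fun hle => hx0 (by
    have := hle hx
    rwa [LinearMap.mem_ker, AlgHom.toLinearMap_apply] at this)⟩

/-- **A nonvanishing value is a late weight.** Under the same arithmetic hypothesis, the weight of ANY
highest-weight vector of nonconstant weight not vanishing at `f` already has `-|χ₀| ≥ D`: the first
degree in which a nonconstant semi-invariant is nonzero at `f` is at least `D/m`. [cite: MulmuleySohoniGCT2SIAM2008, Prop. 4.2] -/
theorem le_neg_size_of_evalAtPoint_ne_zero (f : MvPolynomial σ ℂ) (m : ℕ)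
    (S : Set (GL σ ℂ)) (hS : ∀ t ∈ S, IsUpperTriangular t ∧ linSubstRep σ ℂ t f = f) (D : ℤ)
    (harith : ∀ χ : Weight σ, (∃ i j, χ i ≠ χ j) → (∀ i, χ i ≤ 0) →
      (∀ t ∈ S, weightChar χ t = 1) → D ≤ -(Weight.size χ))
    {χ₀ : Weight σ} (hnc : ∃ i j, χ₀ i ≠ χ₀ j) {x : OrbitCoordRing f m}
    (hx : x ∈ highestWeightSpace (orbitCoordRep f m) χ₀) (hx0 : evalAtPoint f m x ≠ 0) :
    D ≤ -(Weight.size χ₀) := by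
  by_contra hsmall
  have := highestWeightSpace_le_ker_evalAtPoint_of_stabilizer f m S hS D harith χ₀ hnc hsmall hx
  rw [LinearMap.mem_ker, AlgHom.toLinearMap_apply] at this
  exact hx0 this

end General

/-! ## 4. Consequence for the crux: an evaluation-late window-easy family refutes K2 -/

/-- **An evaluation-late easy family refutes K2.** Suppose that for some window exponent `c` and
every `c₀` there are a cell `1 ≤ m`, `m + e ≤ 2^((log₂ m + c)^c)`, a nonzero `m`-form `g` in the `m²`
matrix letters with a power-trace representation of size `m + e` (`pc(g)` inside the window), a set
`S` of upper triangular elements fixing `g`, and `D > m · 2^((log₂ m + c₀)^c₀)` such that every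
nonconstant nonpositive weight annihilated by `S` has `-|χ| ≥ D` while some highest-weight vector of
nonconstant weight does not vanish at `g`. Then `PowGenDegreeQP` (K2) fails — by
`exists_late_genType_of_stabilizer` and the landed transfer
`genQP_of_powGenDegreeQP_of_hasPowTraceRepr`. [cite: GesmundoIkenmeyerPanova2017, Prop. 5] -/
theorem not_powGenDegreeQP_of_evalLate
    (h : ∃ c : ℕ, ∀ c₀ : ℕ, ∃ m e : ℕ, 1 ≤ m ∧ m + e ≤ 2 ^ ((Nat.log 2 m + c) ^ c) ∧
      ∃ g : MvPolynomial (MatIdx m) ℂ, g.IsHomogeneous m ∧ g ≠ 0 ∧ HasPowTraceRepr ℂ g m (m + e) ∧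
        ∃ (S : Set (GL (MatIdx m) ℂ)) (D : ℤ),
          (∀ t ∈ S, IsUpperTriangular t ∧ linSubstRep (MatIdx m) ℂ t g = g) ∧
          (m : ℤ) * 2 ^ ((Nat.log 2 m + c₀) ^ c₀) < D ∧
          (∀ χ : Weight (MatIdx m), (∃ i j, χ i ≠ χ j) → (∀ i, χ i ≤ 0) →
            (∀ t ∈ S, weightChar χ t = 1) → D ≤ -(Weight.size χ)) ∧
          (∃ χ₀ : Weight (MatIdx m), (∃ i j, χ₀ i ≠ χ₀ j) ∧
            ∃ x ∈ highestWeightSpace (orbitCoordRep g m) χ₀, evalAtPoint g m x ≠ 0)) :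
    ¬ PowGenDegreeQP := by
  intro hK2
  obtain ⟨c, hc⟩ := h
  obtain ⟨c₀, hc₀⟩ := genQP_of_powGenDegreeQP_of_hasPowTraceRepr hK2 c
  obtain ⟨m, e, hm, he, g, hg, hg0, hrep, S, D, hS, hD, harith, h2⟩ := hc c₀
  obtain ⟨χ, -, hDle, hγ⟩ :=
    exists_late_genType_of_stabilizer g (m := m) (by omega) S hS D harith h2
  have hb := hc₀ m e hm he g hg hg0 hrep χ hγ
  omega

/-- **The same refutes the registered `stub_sliceGen`** (hypothesis verbatim = its negated
conclusion), through the landed `genQP_of_sliceGen_of_hasPowTraceRepr`. [cite: GesmundoIkenmeyerPanova2017, Prop. 5] -/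
theorem not_sliceGen_of_evalLate
    (h : ∃ c : ℕ, ∀ c₀ : ℕ, ∃ m e : ℕ, 1 ≤ m ∧ m + e ≤ 2 ^ ((Nat.log 2 m + c) ^ c) ∧
      ∃ g : MvPolynomial (MatIdx m) ℂ, g.IsHomogeneous m ∧ g ≠ 0 ∧ HasPowTraceRepr ℂ g m (m + e) ∧
        ∃ (S : Set (GL (MatIdx m) ℂ)) (D : ℤ),
          (∀ t ∈ S, IsUpperTriangular t ∧ linSubstRep (MatIdx m) ℂ t g = g) ∧
          (m : ℤ) * 2 ^ ((Nat.log 2 m + c₀) ^ c₀) < D ∧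
          (∀ χ : Weight (MatIdx m), (∃ i j, χ i ≠ χ j) → (∀ i, χ i ≤ 0) →
            (∀ t ∈ S, weightChar χ t = 1) → D ≤ -(Weight.size χ)) ∧
          (∃ χ₀ : Weight (MatIdx m), (∃ i j, χ₀ i ≠ χ₀ j) ∧
            ∃ x ∈ highestWeightSpace (orbitCoordRep g m) χ₀, evalAtPoint g m x ≠ 0)) :
    ¬ (∀ c : ℕ, ∃ c₀ : ℕ, ∀ m e : ℕ, 1 ≤ m → m + e ≤ 2 ^ ((Nat.log 2 m + c) ^ c) →
      ∀ ι : MatIdx m → MatIdx (m + e), StrictMono ι → IsUpperSet (Set.range ι) →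
        ∀ χ : Weight (MatIdx m),
          Module.finrank ℂ (↥(highestWeightSpace (orbitCoordRep (powFormLex ℂ (m + e) m) m) (Function.extend ι χ 0)) ⧸ Submodule.comap (highestWeightSpace (orbitCoordRep (powFormLex ℂ (m + e) m) m) (Function.extend ι χ 0)).subtype (⨆ p : Weight (MatIdx (m + e)) × Weight (MatIdx (m + e)), ⨆ (_ : p.1 + p.2 = (Function.extend ι χ 0) ∧ p.1 ≠ 0 ∧ p.2 ≠ 0), highestWeightSpace (orbitCoordRep (powFormLex ℂ (m + e) m) m) p.1 * highestWeightSpace (orbitCoordRep (powFormLex ℂ (m + e) m) m) p.2)) ≠ 0 →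
            -(Weight.size χ) ≤ (m : ℤ) * 2 ^ ((Nat.log 2 m + c₀) ^ c₀)) := by
  intro hstub
  obtain ⟨c, hc⟩ := h
  obtain ⟨c₀, hc₀⟩ := genQP_of_sliceGen_of_hasPowTraceRepr hstub c
  obtain ⟨m, e, hm, he, g, hg, hg0, hrep, S, D, hS, hD, harith, h2⟩ := hc c₀
  obtain ⟨χ, -, hDle, hγ⟩ :=
    exists_late_genType_of_stabilizer g (m := m) (by omega) S hS D harith h2
  have hb := hc₀ m e hm he g hg hg0 hrep χ hγ
  omega

end

end Summit.ValiantsHypothesis.ValiantsHypothesis.Theorems.GeneratorObstructions.PowGenDegreeQP
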